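/-
Copyright: the b2b-balaban T⁴-continuum CRUX team, row NE7b OWNER lineage `t4-ne7b-p1` (gen 148). Project licence.
-/
import Mathlib.Analysis.SpecialFunctions.Exp
import Summits.QuantumFields.BalabanUV.T4Continuum.Spine.NE7b.SupWeightedClassPowerCounting

/-!
# THE END OF THE LINE (d19 §D (2)): ON THE TORUS TOWER AT `d = 4` THE ORDER-5 LETTER OF THE WEIGHTED CLASS STAYS IN A PERIOD-FREE BALL
# ALONG THE SCALES — GIVEN BOUNDED SOURCES (file (788)).  Assemble (773)∕(780)–(783) (one full step at order 5 in every role: next letter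
# `≤ |t|⁵·n_blk·M¹⁰·(letter + cross terms + source)`), (786) (torus geometry: `n_blk = (n+1)⁴` sites per block of side `n+1`, block factor
# `M = e^{ν₂·4n∕(n+1)}`), (431)∕(784) (`t = (n+1)⁻¹`: the factor is `M¹⁰∕(n+1)`), (787) (admissible stationary rates: `M¹⁰(1+a) < n+1` is
# attainable for every `n + 1 > 384`) and (436)∕(784) §3 (the affine recursion's invariant ball and attraction):
#   if along the tower the order-5 letter obeys the one-step bound with cross coefficient `a` and sources `S_j ≤ S̄`, then with
#   `μ := M¹⁰(1+a)∕(n+1) < 1`, `C := M¹⁰S̄∕(n+1)`:  `K_j ≤ max(K_0, C∕(1−μ))` and `K_j ≤ μ^j K_0 + C∕(1−μ)` for every scale `j`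
# — uniformly in `j` and in the periods of the tori.  The hypothesis `S_j ≤ S̄` IS the boundedness of the lower-order (relevant∕marginal)
# letters along the flow: NOT claimed ((784) §4: the class map does not contract them; extraction∕tuning (432)∕(434)∕(435) and the
# β-function are the road) (row NE7b, node U5c; (784) `weighted_factor_five`, `irrelevant_orbit` BY NAME; [folklore]).

Cell `pub-balaban`, sub-cell `t4`, spine estimate NE7b (`T4WeightBudget.RelWeightBound`; the cell's OWN estimate — NOT PRINTED in
[Bałaban 1983–89], NOT PROVED).  Crux-route work under `Spine/NE7b/` by the row OWNER (`t4-ne7b-p1` gen 148, file (788)) under FREEZE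
(0)'s crux-prover clause; NOTHING of Bałaban's is named as a Lean object, valued or asserted; no `T4Continuum/Support` leaf typed; no
`def`, no notation (factor, rate and radius WRITTEN OUT); zero `sorry`.  Imports (BY NAME): (784) `…SupWeightedClassPowerCounting`
(`weighted_factor_five`, `irrelevant_orbit`; (436) through it); the step files' factor shape `|t| ^ 5 * ↑n_blk * M ^ 10`, (786)'s
`n_blk = (n+1)^4`∕`M = e^{ν₂(4n∕(n+1))}` and (787)'s contraction `M¹⁰(1+a) < n+1` are met BY SHAPE.

WHAT IS PROVED ([folklore]; block side `n+1`, `K S : ℕ → ℝ` the order-5 letter and its source along the scales):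
* §1 `torus_factor_five` (`|(n+1)⁻¹|⁵·↑((n+1)⁴)·M¹⁰ = M¹⁰∕(n+1)`), `torus_rate_lt_one` (`M¹⁰(1+a) < n+1 ⟹ M¹⁰∕(n+1)·(1+a) < 1`).
* §2 `affine_of_step` (the one-step bound with `S_j ≤ S̄` is the affine recursion `K_{j+1} ≤ μK_j + C`).
* §3 **`order_five_ball_torus`** (THE END: `∀ j, K_j ≤ max(K_0, C∕(1−μ)) ∧ K_j ≤ μ^j·K_0 + C∕(1−μ)`, `μ = M¹⁰(1+a)∕(n+1)`, `C = M¹⁰S̄∕(n+1)`,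
  `M = e^{ν₂·4n∕(n+1)}`).
* §4 toy.

HONEST (what this is NOT).  A conditional, bookkeeping-level flow statement for ONE family of letters (order 5, max over roles) of the
scalar skeleton's weighted class: the sources `S_j` (products of the order-2∕3∕4 letters and the Gaussian constants printed in
(756)–(762)) are ASSUMED bounded along the tower — that is the relevant∕marginal flow, NOT claimed; large fields, the road's regularised
Gaussians and the identification `t = (n+1)⁻¹` ((429)∕(431)) met BY SHAPE; scalar skeleton ((A3), NC-NE7b-α UNRULED); nothing of Bałaban's
asserted.  BY-NAME EFFECT ON THE WALL: NONE.  NE7b NOT PRINTED ∕ NOT PROVED; spine PROVED 0∕9; rung (B)+1 — the programme's measures remain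
FINITE-torus statements; NOT the mass gap, NOT Clay.  HONEST DEPENDENCY: continuum YM on T⁴ ⇐ BetaPertH ∧ nine spine estimates (0∕9 proved);
BetaPertH ⇐ (D1) ∧ (D4) ∧ CAP+tail; G-an2-4 gates asym, D1 and NE2∕3∕4.
-/

set_option autoImplicit false

noncomputable section

namespace Summit.QuantumFields.BalabanUV.T4Continuum.NE7b.SupWeightedRemainderBallTorus

open SupWeightedClassPowerCounting (weighted_factor_five irrelevant_orbit)

variable {n : ℕ} {ν₂ a Sbar : ℝ}

/-! ## §1. The transport factor on the torus tower at `d = 4` -/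

/-- **THE ORDER-5 FACTOR ON THE TORUS TOWER**: `t = (n+1)⁻¹`, `n_blk = (n+1)⁴` ⟹ `|t|⁵·↑n_blk·M¹⁰ = M¹⁰∕(n+1)` ((784) at `L = n+1`). [folklore] -/
theorem torus_factor_five (n : ℕ) (M : ℝ) :
    |((n : ℝ) + 1)⁻¹| ^ 5 * (((n + 1) ^ 4 : ℕ) : ℝ) * M ^ 10 = M ^ 10 / ((n : ℝ) + 1) := by
  have hL : (0 : ℝ) < (n : ℝ) + 1 := by positivity
  have e : (((n + 1) ^ 4 : ℕ) : ℝ) = ((n : ℝ) + 1) ^ 4 := by push_cast; ring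
  rw [e]
  exact weighted_factor_five hL

/-- **THE RATE IS BELOW ONE** under (787)'s contraction `M¹⁰(1+a) < n+1`: `M¹⁰∕(n+1)·(1+a) < 1`. [folklore] -/
theorem torus_rate_lt_one (n : ℕ) {M : ℝ} (hcon : M ^ 10 * (1 + a) < (n : ℝ) + 1) : M ^ 10 / ((n : ℝ) + 1) * (1 + a) < 1 := by
  have hL : (0 : ℝ) < (n : ℝ) + 1 := by positivity
  rw [div_mul_eq_mul_div, div_lt_one hL]
  exact hcon

/-! ## §2. The one-step bound along the tower is an affine recursion -/

/-- **READ-OFF ALONG THE TOWER**: the one-step bound `K_{j+1} ≤ T·(K_j + a·K_j + S_j)` with `T ≥ 0` and sources `S_j ≤ S̄` is the affine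
recursion `K_{j+1} ≤ (T(1+a))·K_j + T·S̄`. [folklore] -/
theorem affine_of_step {K S : ℕ → ℝ} {T : ℝ} (hT : 0 ≤ T) (hS : ∀ j, S j ≤ Sbar)
    (hstep : ∀ j, K (j + 1) ≤ T * (K j + a * K j + S j)) : ∀ j, K (j + 1) ≤ T * (1 + a) * K j + T * Sbar := by
  intro j
  have h1 : T * S j ≤ T * Sbar := mul_le_mul_of_nonneg_left (hS j) hT
  calc K (j + 1) ≤ T * (K j + a * K j + S j) := hstep j
    _ = T * (1 + a) * K j + T * S j := by ring
    _ ≤ T * (1 + a) * K j + T * Sbar := by linarith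

/-! ## §3. The end: the order-5 letter stays in a period-free ball along the torus tower -/

/-- **THE ORDER-5 LETTER STAYS IN A BALL ALONG THE TORUS TOWER AT `d = 4`** (blocks of side `n+1`, block factor `M = e^{ν₂·4n∕(n+1)}`,
cross coefficient `a ≥ 0`, sources `0 ≤ S_j ≤ S̄`, contraction `M¹⁰(1+a) < n+1`): if the order-5 letter obeys the one-step bound of the
step files at every scale, `K_{j+1} ≤ |(n+1)⁻¹|⁵·↑((n+1)⁴)·M¹⁰·(K_j + aK_j + S_j)`, then for every `j`
`K_j ≤ max(K_0, C∕(1−μ))` and `K_j ≤ μ^j·K_0 + C∕(1−μ)` with `μ = M¹⁰∕(n+1)·(1+a)`, `C = M¹⁰∕(n+1)·S̄` — uniformly in the scale and in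
the periods.  The boundedness of the sources is the relevant∕marginal flow, ASSUMED. [folklore] -/
theorem order_five_ball_torus (n : ℕ) (ha : 0 ≤ a) (hS0 : 0 ≤ Sbar)
    (hcon : Real.exp (ν₂ * (4 * n / ((n : ℝ) + 1))) ^ 10 * (1 + a) < (n : ℝ) + 1) {K S : ℕ → ℝ} (hK0 : ∀ j, 0 ≤ K j)
    (hS : ∀ j, S j ≤ Sbar)
    (hstep : ∀ j, K (j + 1) ≤ |((n : ℝ) + 1)⁻¹| ^ 5 * (((n + 1) ^ 4 : ℕ) : ℝ) * Real.exp (ν₂ * (4 * n / ((n : ℝ) + 1))) ^ 10 *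
      (K j + a * K j + S j)) :
    ∀ j : ℕ,
      K j ≤ max (K 0) (Real.exp (ν₂ * (4 * n / ((n : ℝ) + 1))) ^ 10 / ((n : ℝ) + 1) * Sbar /
          (1 - Real.exp (ν₂ * (4 * n / ((n : ℝ) + 1))) ^ 10 / ((n : ℝ) + 1) * (1 + a))) ∧
      K j ≤ (Real.exp (ν₂ * (4 * n / ((n : ℝ) + 1))) ^ 10 / ((n : ℝ) + 1) * (1 + a)) ^ j * K 0 +
          Real.exp (ν₂ * (4 * n / ((n : ℝ) + 1))) ^ 10 / ((n : ℝ) + 1) * Sbar /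
            (1 - Real.exp (ν₂ * (4 * n / ((n : ℝ) + 1))) ^ 10 / ((n : ℝ) + 1) * (1 + a)) := by
  set M : ℝ := Real.exp (ν₂ * (4 * n / ((n : ℝ) + 1))) with hM
  have hL : (0 : ℝ) < (n : ℝ) + 1 := by positivity
  have hT0 : 0 ≤ M ^ 10 / ((n : ℝ) + 1) := div_nonneg (pow_nonneg (Real.exp_pos _).le 10) hL.le
  -- the step bound in the factor `T = M¹⁰∕(n+1)`
  have hstep' : ∀ j, K (j + 1) ≤ M ^ 10 / ((n : ℝ) + 1) * (K j + a * K j + S j) := fun j => by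
    have h := hstep j
    rwa [torus_factor_five n M] at h
  have hrec := affine_of_step hT0 hS hstep'
  have hμ0 : 0 ≤ M ^ 10 / ((n : ℝ) + 1) * (1 + a) := mul_nonneg hT0 (by linarith)
  have hμ1 : M ^ 10 / ((n : ℝ) + 1) * (1 + a) < 1 := torus_rate_lt_one n hcon
  have hC : 0 ≤ M ^ 10 / ((n : ℝ) + 1) * Sbar := mul_nonneg hT0 hS0
  have horbit := irrelevant_orbit (r := max (K 0) (M ^ 10 / ((n : ℝ) + 1) * Sbar / (1 - M ^ 10 / ((n : ℝ) + 1) * (1 + a))))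
    hμ0 hμ1 hC hK0 hrec (le_max_right _ _) (le_max_left _ _)
  exact horbit

/-! ## §4. Toy -/

/-- Toy (kernel): at `n + 1 = 400`, `M¹⁰(1+a) = 200` the rate is `1∕2` and a source bound `S̄` with `M¹⁰S̄∕400 = 3` gives the radius
`3∕(1 − 1∕2) = 6`. -/
example : (3 : ℝ) / (1 - 200 / 400) = 6 := by norm_num

end Summit.QuantumFields.BalabanUV.T4Continuum.NE7b.SupWeightedRemainderBallTorus

end
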